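import Summits.Ventures.HodgeRepro2.Incoherent

/-!
# T4Incoherent — row L3 of the Tier-4 identification table (T4-B): the incoherent space

Seat p3 of the blind cell `pub-hodge-repro2` (Tier 4, README §6).  Companion of
`T4Identification.lean`, which imports it; split off for the 400-line rule.

Row L3 of route/TIER3.md §4.4: Liu 2021 (Cambridge J. Math. 9) works with a TOTALLY (positive)
DEFINITE INCOHERENT hermitian space `𝕍` over `𝔸_E` of rank `n` (Definition C.3, p. 108
ll. 63–70: «its determinant belongs to `𝔸_F^× ∖ F^× N_{𝔸_E/𝔸_F} 𝔸_E^×`») whose `τ`-nearby space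
(Definition C.4, p. 109 ll. 8–17: same finite components, signature `(n − 1, 1)` at `τ`) is the
global hermitian space of the Shimura variety `Sh(G(τ), h_{V(τ),τ′})`.  The transfer's surface
is attached to the COHERENT space `V` of signature `(2, 1)` at `τ₁` and `(3, 0)` at the other two
real places of `𝐅⁺`.  In seat p2's local-invariant model `HermitianLocalData` (Incoherent.lean:
finite invariants `ε_v ∈ {±1}`, almost all `+1`; real signatures; coherent ⟺ the product of all
local invariants is `+1`, the real invariant at a place of signature `(p, q)` being `(−1)^q` —
Gross 2021 §3–§4, Liu App. C) this file proves:

* `totallyDefinite d` — the datum with the same finite invariants as `d` and signature `(n, 0)`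
  at every infinite place — is totally definite (`isTotallyDefinite_totallyDefinite`);
* if `d` is a coherent Picard datum (`(m, 1)` at `τ₁`, `(m + 1, 0)` elsewhere), then
  `totallyDefinite d` is INCOHERENT (`isIncoherent_totallyDefinite`: the product of the real
  signs of `d` is `−1`, `prod_realSign_picard`, so flipping `τ₁` to definite flips the product);
* the `τ₁`-nearby space of `totallyDefinite d` IS `d` (`nearby_totallyDefinite`) — Liu's
  `V(τ₁) = V`, the identification the printed Proposition C.5 needs;
* a coherent Picard datum exists as soon as one finite place of `F` is given
  (`exists_coherent_picard`: finite invariant `−1` at that place, `+1` elsewhere).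

Axioms: propext, Classical.choice, Quot.sound.
-/

namespace Summit.Ventures.HodgeRepro2.T4Identification

open NumberField
open Summit.Ventures.HodgeRepro2.ShimuraData

/-! ## Row L3 — the incoherent totally definite space and its `τ₁`-nearby space -/

section Incoherent

open Classical

variable {F K : Type*} [Field F] [NumberField F] [Field K] [NumberField K]

/-- The totally definite local datum with the SAME finite invariants as `d` and signature
`(n, 0)` at every infinite place (Liu Definition C.3: «totally positive definite»). -/
def totallyDefinite {n : ℕ} (d : HermitianLocalData F K n) : HermitianLocalData F K n where
  epsFin := d.epsFin
  epsFin_finite := d.epsFin_finite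
  sig := fun _ => (n, 0)
  sig_sum := fun _ => by simp

/-- The finite invariants are unchanged. -/
@[simp] theorem totallyDefinite_epsFin {n : ℕ} (d : HermitianLocalData F K n) :
    (totallyDefinite d).epsFin = d.epsFin := rfl

/-- The signature of the totally definite datum. -/
@[simp] theorem totallyDefinite_sig {n : ℕ} (d : HermitianLocalData F K n)
    (w : InfinitePlace K) : (totallyDefinite d).sig w = (n, 0) := rfl

/-- The totally definite datum is totally definite (Def C.3). -/
theorem isTotallyDefinite_totallyDefinite {n : ℕ} (d : HermitianLocalData F K n) :
    (totallyDefinite d).IsTotallyDefinite := fun _ => rfl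

/-- The real sign of the totally definite datum is `+1` everywhere. -/
theorem realSign_totallyDefinite {n : ℕ} (d : HermitianLocalData F K n)
    (w : InfinitePlace K) : (totallyDefinite d).realSign w = 1 := by
  simp [HermitianLocalData.realSign]

/-- The real sign of a Picard datum (`(m, 1)` at `τ₁`, `(m+1, 0)` elsewhere). -/
theorem realSign_picard {m : ℕ} (d : HermitianLocalData F K (m + 1)) (τ₁ : InfinitePlace K)
    (h₁ : d.sig τ₁ = (m, 1)) (h₂ : ∀ w, w ≠ τ₁ → d.sig w = (m + 1, 0)) (w : InfinitePlace K) :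
    d.realSign w = if w = τ₁ then -1 else 1 := by
  unfold HermitianLocalData.realSign
  split_ifs with hw
  · subst hw; simp [h₁]
  · simp [h₂ w hw]

/-- The product of the real signs of a Picard datum is `−1`. -/
theorem prod_realSign_picard {m : ℕ} (d : HermitianLocalData F K (m + 1)) (τ₁ : InfinitePlace K)
    (h₁ : d.sig τ₁ = (m, 1)) (h₂ : ∀ w, w ≠ τ₁ → d.sig w = (m + 1, 0)) :
    ∏ w, d.realSign w = -1 := by
  rw [Finset.prod_eq_single τ₁]
  · rw [realSign_picard d τ₁ h₁ h₂ τ₁, if_pos rfl]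
  · intro w _ hw
    rw [realSign_picard d τ₁ h₁ h₂ w, if_neg hw]
  · intro h
    exact absurd (Finset.mem_univ τ₁) h

/-- The product of the local invariants of the totally definite datum is the NEGATIVE of that of
a Picard datum with the same finite invariants. -/
theorem productOfInvariants_totallyDefinite_picard {m : ℕ} (d : HermitianLocalData F K (m + 1))
    (τ₁ : InfinitePlace K) (h₁ : d.sig τ₁ = (m, 1))
    (h₂ : ∀ w, w ≠ τ₁ → d.sig w = (m + 1, 0)) :
    (totallyDefinite d).productOfInvariants = -d.productOfInvariants := by
  unfold HermitianLocalData.productOfInvariants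
  rw [prod_realSign_picard d τ₁ h₁ h₂, totallyDefinite_epsFin]
  have : ∏ w, (totallyDefinite d).realSign w = 1 := by
    apply Finset.prod_eq_one
    intro w _
    exact realSign_totallyDefinite d w
  rw [this, mul_one, mul_neg, mul_one, neg_neg]

/-- ROW L3, INCOHERENCE: if the surface's space `V` (signature `(m, 1)` at `τ₁`, definite
elsewhere) is coherent — a global hermitian space — then the totally definite space with the same
finite invariants is INCOHERENT (Liu Definition C.3: «its determinant belongs to
`𝔸_F^× ∖ F^× N_{𝔸_E/𝔸_F} 𝔸_E^×`»; in p2's model: the product of the local invariants is `−1`). -/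
theorem isIncoherent_totallyDefinite {m : ℕ} (d : HermitianLocalData F K (m + 1))
    (τ₁ : InfinitePlace K) (h₁ : d.sig τ₁ = (m, 1))
    (h₂ : ∀ w, w ≠ τ₁ → d.sig w = (m + 1, 0)) (hcoh : d.IsCoherent) :
    (totallyDefinite d).IsIncoherent := by
  unfold HermitianLocalData.IsIncoherent
  rw [productOfInvariants_totallyDefinite_picard d τ₁ h₁ h₂]
  unfold HermitianLocalData.IsCoherent at hcoh
  rw [hcoh]

/-- ROW L3, THE NEARBY SPACE: the `τ₁`-nearby space (Definition C.4: same finite invariants,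
signature `(n − 1, 1)` at `τ₁`) of the totally definite datum IS the surface's datum `V`. -/
theorem nearby_totallyDefinite {m : ℕ} (d : HermitianLocalData F K (m + 1))
    (τ₁ : InfinitePlace K) (h₁ : d.sig τ₁ = (m, 1))
    (h₂ : ∀ w, w ≠ τ₁ → d.sig w = (m + 1, 0)) :
    (totallyDefinite d).nearby τ₁ = d := by
  unfold HermitianLocalData.nearby
  obtain ⟨epsFin, epsFin_finite, sig, sig_sum⟩ := d
  simp only at h₁ h₂
  simp only [totallyDefinite, HermitianLocalData.mk.injEq, true_and]
  funext w
  by_cases hw : w = τ₁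
  · subst hw
    rw [Function.update_self]
    exact h₁.symm
  · rw [Function.update_of_ne hw]
    exact (h₂ w hw).symm

/-- EXISTENCE of a coherent Picard datum: given one finite place `v₀` of `F`, the datum with
finite invariant `−1` at `v₀` and `+1` elsewhere, signature `(m, 1)` at `τ₁` and `(m + 1, 0)` at
the other infinite places, is COHERENT (its product of local invariants is `(−1)·(−1) = 1`) — the
local-invariant shape of the surface's space (Dimitrov–Ramakrishnan 2015 p. 1: «an anisotropic
hermitian form on `M³` of signature `(2,1)` at one infinite place and `(3,0)` at the others»;
Shimura 2008 Theorem 2.2(ii); p2's `picardHermitianFormExists` for the matrix form). -/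
theorem exists_coherent_picard (m : ℕ) (τ₁ : InfinitePlace K)
    (v₀ : IsDedekindDomain.HeightOneSpectrum (RingOfIntegers F)) :
    ∃ d : HermitianLocalData F K (m + 1),
      d.IsCoherent ∧ d.sig τ₁ = (m, 1) ∧ ∀ w, w ≠ τ₁ → d.sig w = (m + 1, 0) := by
  classical
  let eps : IsDedekindDomain.HeightOneSpectrum (RingOfIntegers F) → ℤˣ :=
    fun v => if v = v₀ then -1 else 1
  let sig : InfinitePlace K → ℕ × ℕ := fun w => if w = τ₁ then (m, 1) else (m + 1, 0)
  have hsig : ∀ w, (sig w).1 + (sig w).2 = m + 1 := by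
    intro w
    simp only [sig]
    split_ifs <;> simp
  have hfin : {v | eps v ≠ 1}.Finite := by
    apply Set.Finite.subset (Set.finite_singleton v₀)
    intro v hv
    simp only [Set.mem_setOf_eq, eps] at hv
    by_contra hne
    exact hv (if_neg hne)
  refine ⟨⟨eps, hfin, sig, hsig⟩, ?_, ?_, ?_⟩
  · unfold HermitianLocalData.IsCoherent HermitianLocalData.productOfInvariants
    have h₁ : sig τ₁ = (m, 1) := if_pos rfl
    have h₂ : ∀ w, w ≠ τ₁ → sig w = (m + 1, 0) := fun w hw => if_neg hw
    have hprod := prod_realSign_picard (⟨eps, hfin, sig, hsig⟩ : HermitianLocalData F K (m + 1))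
      τ₁ h₁ h₂
    rw [hprod]
    have hfp : ∏ᶠ v, eps v = -1 := by
      rw [finprod_eq_single eps v₀ (fun v hv => if_neg hv)]
      exact if_pos rfl
    change (∏ᶠ v, eps v) * (-1) = 1
    rw [hfp]
    decide
  · exact if_pos rfl
  · exact fun w hw => if_neg hw

end Incoherent

end Summit.Ventures.HodgeRepro2.T4Identification
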